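import Mathlib
import HarnessLib
import Literature.Computability.AlgebraicComplexity.DepthReductionProofs
import Summits.ValiantsHypothesis.ValiantsHypothesis.Theorems.MonotoneRestorationMonotoneRestorationQPZetaHomogeneous
import Summits.ValiantsHypothesis.ValiantsHypothesis.Theorems.MonotoneRestorationOrbitRestorationQPSmlAffinePermanentQP

/-!
# The permanent family is NOT in the affine set-multilinear class (polynomial budget, the hypothesis of the landed stratum)
(crux `OrbitRestorationQP`, stmt-ValiantsHypothesis-18293 — lane SML of stub A_∞; calibration)

`…SmlAffinePermanentQP.lean` excludes affine column- or row-set-multilinear expressions of `per_n` with `≤ 2^((log₂ n + c)^c)` product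
gates for large `n`.  Since `n^c + c ≤ 2 (n+2)^c ≤ 2^((log₂ n + c₃)^{c₃})` (`DepthReduction.le_two_mul_pow`, `zeta_poly_mul_qp_le`),
the hypothesis of `SmlAffineRestoration.affineSml_restoration` fails for the family `per`:

* `perPoly_eventually_not_affineSml_poly` — for every `c` and all large `n`, `per_n` has no affine column- or row-sml expression
  with `≤ n^c + c` product gates;
* `perPoly_not_affineSml_family` — **`¬ ∃ c, ∀ n, (per_n has an affine column- or row-sml expression with ≤ n^c + c gates)`.**

So the stratum (which HOLDS, `…SmlAffinePDClass.lean`) and its deciding non-member are both certified: consistent with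
Dawar–Wilsenach Thm 7.1 (`per` is not quasi-polynomially orbit-restorable).  Honest label: calibration; VP ≠ VNP untouched.
[folklore]
-/

noncomputable section

open scoped Classical

-- `Summit.ValiantsHypothesis.ValiantsHypothesis.…` is the tree's single-conjunct layout (Sub = Summit).
set_option linter.dupNamespace false

namespace Summit.ValiantsHypothesis.ValiantsHypothesis.Theorems.SmlAffinePermanent

open MvPolynomial Finset Literature.Computability.AlgebraicComplexity Literature.Computability.AlgebraicComplexity.DepthReduction

/-- `n^c + c ≤ 2^((log₂ n + c₃)^{c₃})` uniformly in `n`. [folklore] -/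
theorem pow_add_le_qp (c : ℕ) : ∃ c₃ : ℕ, ∀ n : ℕ, n ^ c + c ≤ 2 ^ ((Nat.log 2 n + c₃) ^ c₃) := by
  obtain ⟨c₃, hc₃⟩ := zeta_poly_mul_qp_le 2 c 0 0
  refine ⟨c₃, fun n => ?_⟩
  have h1 : n ^ c + c ≤ 2 * (n + 2) ^ c := le_two_mul_pow le_rfl le_rfl
  have h2 := hc₃ n
  rw [zero_mul, pow_zero, mul_one] at h2
  exact h1.trans h2

/-- **For every `c` and all large `n`, `per_n` has no affine column- or row-sml expression with `≤ n^c + c` product gates.**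
[folklore] -/
theorem perPoly_eventually_not_affineSml_poly (c : ℕ) : ∃ n₀ : ℕ, ∀ n : ℕ, n₀ ≤ n →
    ¬ ∃ (s : ℕ) (β : Fin s → Fin n → ℂ) (α : Fin s → Fin n → Fin n → ℂ), s ≤ n ^ c + c ∧
      (perPoly (Fin n) ℂ = ∑ t : Fin s, ∏ b : Fin n, (C (β t b) + ∑ a : Fin n, C (α t b a) * X (a, b)) ∨
       perPoly (Fin n) ℂ = ∑ t : Fin s, ∏ a : Fin n, (C (β t a) + ∑ b : Fin n, C (α t a b) * X (a, b))) := by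
  obtain ⟨c₃, hc₃⟩ := pow_add_le_qp c
  obtain ⟨n₀, h⟩ := perPoly_eventually_not_affineSml c₃
  refine ⟨n₀, fun n hn => ?_⟩
  rintro ⟨s, β, α, hs, hper⟩
  exact h n hn ⟨s, β, α, hs.trans (hc₃ n), hper⟩

/-- **The permanent family is not in the affine set-multilinear class** (the hypothesis class of
`SmlAffineRestoration.affineSml_restoration` / `sigmaPiSigmaValue_on_affineSml`). [folklore] -/
theorem perPoly_not_affineSml_family :
    ¬ ∃ c : ℕ, ∀ n : ℕ, ∃ (s : ℕ) (β : Fin s → Fin n → ℂ) (α : Fin s → Fin n → Fin n → ℂ), s ≤ n ^ c + c ∧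
      ((fun n => perPoly (Fin n) ℂ) n = ∑ t : Fin s, ∏ b : Fin n, (C (β t b) + ∑ a : Fin n, C (α t b a) * X (a, b)) ∨
       (fun n => perPoly (Fin n) ℂ) n = ∑ t : Fin s, ∏ a : Fin n, (C (β t a) + ∑ b : Fin n, C (α t a b) * X (a, b))) := by
  rintro ⟨c, hc⟩
  obtain ⟨n₀, h⟩ := perPoly_eventually_not_affineSml_poly c
  exact h n₀ le_rfl (hc n₀)

end Summit.ValiantsHypothesis.ValiantsHypothesis.Theorems.SmlAffinePermanent

end
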